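import Mathlib
import HarnessLib
import Summits.ValiantsHypothesis.ValiantsHypothesis.Theorems.MonotoneRestorationOrbitRestorationQPSmlColNarrow
import Summits.ValiantsHypothesis.ValiantsHypothesis.Theorems.MonotoneRestorationOrbitRestorationQPSmlInjective
import Summits.ValiantsHypothesis.ValiantsHypothesis.Theorems.MonotoneRestorationOrbitRestorationQPSmlNarrowSpan

/-!
# The equivariant normal form of a small column-set-multilinear `ΣΠΣ` circuit
(crux `OrbitRestorationQP`, stmt-ValiantsHypothesis-18293 — lane SML: the column-set-multilinear `ΣΠΣ` stratum of A_∞)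

F6d-1 of the blueprint `SML-STRATUM-BLUEPRINT.md`.  The GENERATING FACTORS are the column-linear forms

  `Λ τ g b = Σ_a (1 + Σ_{i : g i = a} τ_i) · x_{(a,b)} = C_b + Σ_i τ_i x_{(g i, b)}`

(`τ : Fin w → Fin (n+1)` a grid point, `g : Fin w → Fin n` the distinguished rows, `C_b` the column sum).  Results:

* `rename_fst_prod_genFactor` — `rename fst (Π_b Λ τ g b) = (p_1 + Σ_i τ_i y_{g i})^n`;
* `psumProd_multiset_mem_span_Q` — a power-sum product over a multiset of positive parts with sum `n` and at most
  `w` parts `≥ 2` lies in the span of the `Q τ = Σ_g (p_1 + Σ_i τ_i y_{g i})^n`;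
* **`exists_equivariant_form`** — if `f = Σ_{t<s} Π_b (Σ_a α_{t,b,a} x_{(a,b)})` is row- and column-symmetric with
  `s < C(n-(w+1), w+1)`, `2(w+1) ≤ n`, then for some `d : (Fin w → Fin (n+1)) → ℂ`
  `f = Σ_{τ} Σ_{g} C (d τ) · Π_b Λ τ g b` — an explicit `ΣΠΣ` expression with `(n+1)^w · n^w` product gates whose term
  multiset is stable under the diagonal action of `Sym(Fin n)` (it only moves `g`).
[folklore]
-/

set_option linter.dupNamespace false

namespace Summit.ValiantsHypothesis.ValiantsHypothesis.Theorems.SmlEquivariantForm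

open MvPolynomial Finset SmlColNarrow SmlInjective SmlNarrowSpan

/-! ### The generating factors -/

/-- The `x ↦ y` image of the generating factor of column `b`: `Σ_a (1 + Σ_{i : g i = a} τ_i) y_a = p_1 + Σ_i τ_i y_{g i}`.
[folklore] -/
theorem sum_genCoeff_mul_X {n w : ℕ} (τ : Fin w → Fin (n + 1)) (g : Fin w → Fin n) :
    (∑ a : Fin n, C (1 + ∑ i : Fin w, if g i = a then ((τ i : ℕ) : ℂ) else 0) * X a : MvPolynomial (Fin n) ℂ) =
      psum (Fin n) ℂ 1 + ∑ i : Fin w, C (((τ i : ℕ) : ℂ)) * X (g i) := by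
  classical
  simp only [map_add, map_sum, add_mul, Finset.sum_add_distrib, map_one, one_mul, Finset.sum_mul]
  congr 1
  · simp [psum]
  · rw [Finset.sum_comm]
    refine Finset.sum_congr rfl fun i _ => ?_
    rw [Finset.sum_eq_single (g i)]
    · simp
    · intro a _ ha; simp [Ne.symm ha]
    · intro h; exact absurd (Finset.mem_univ _) h

/-- `rename fst (Π_b Λ τ g b) = (p_1 + Σ_i τ_i y_{g i})^n`. [folklore] -/
theorem rename_fst_prod_genFactor {n w : ℕ} (τ : Fin w → Fin (n + 1)) (g : Fin w → Fin n) :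
    rename (Prod.fst : Fin n × Fin n → Fin n)
        (∏ b : Fin n, ∑ a : Fin n, C (1 + ∑ i : Fin w, if g i = a then ((τ i : ℕ) : ℂ) else 0) * X (a, b)) =
      (psum (Fin n) ℂ 1 + ∑ i : Fin w, C (((τ i : ℕ) : ℂ)) * X (g i)) ^ n := by
  simp only [map_prod, map_sum, map_mul, rename_C, rename_X]
  rw [Finset.prod_const, Finset.card_univ, Fintype.card_fin, sum_genCoeff_mul_X]

/-! ### From a narrow multiset to the generating family -/

/-- Products and sums along `getD` of a list. [folklore] -/
theorem prod_range_getD {M : Type*} [CommMonoid M] (f : ℕ → M) :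
    ∀ L : List ℕ, ∏ i ∈ Finset.range L.length, f (L.getD i 0) = (L.map f).prod := by
  intro L
  induction L with
  | nil => simp
  | cons x L ih =>
    rw [List.length_cons, Finset.prod_range_succ', List.map_cons, List.prod_cons, List.getD_cons_zero]
    simp only [List.getD_cons_succ]
    rw [ih, mul_comm]

/-- Sums along `getD` of a list of naturals. [folklore] -/
theorem sum_range_getD : ∀ L : List ℕ, ∑ i ∈ Finset.range L.length, L.getD i 0 = L.sum := by
  intro L
  induction L with
  | nil => simp
  | cons x L ih =>
    rw [List.length_cons, Finset.sum_range_succ', List.sum_cons, List.getD_cons_zero]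
    simp only [List.getD_cons_succ]
    rw [ih, add_comm]

/-- Every `getD` value of a list is a member or the default. [folklore] -/
theorem getD_mem_or_eq (L : List ℕ) (d : ℕ) : ∀ i : ℕ, L.getD i d ∈ L ∨ L.getD i d = d := by
  induction L with
  | nil => intro i; right; simp
  | cons x L ih =>
    intro i
    cases i with
    | zero => left; simp
    | succ i =>
      rw [List.getD_cons_succ]
      rcases ih i with h | h
      · left; exact List.mem_cons_of_mem _ h
      · right; exact h

/-- **A narrow power-sum product lies in the span of the generating family.**  For a multiset `μ` of positive integers
with `μ.sum = n`, `n ≥ 1`, and at most `w` parts `≥ 2`:  `Π_{k∈μ} p_k ∈ span {Σ_g (p_1 + Σ_i τ_i y_{g i})^n : τ}`.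
[folklore] -/
theorem psumProd_multiset_mem_span_Q {n w : ℕ} (hn : 1 ≤ n) (μ : Multiset ℕ) (hpos : ∀ k ∈ μ, 0 < k)
    (hsum : μ.sum = n) (hw : (μ.filter fun k => 2 ≤ k).card ≤ w) :
    (μ.map (psum (Fin n) ℂ)).prod ∈
      Submodule.span ℂ (Set.range fun τ : Fin w → Fin (n + 1) =>
        ∑ g : Fin w → Fin n, (psum (Fin n) ℂ 1 + ∑ i : Fin w, C (((τ i : ℕ) : ℂ)) * X (g i)) ^ n) := by
  classical
  set ν := μ.filter fun k => 2 ≤ k with hν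
  set u := μ.filter fun k => ¬ 2 ≤ k with hu
  have hμ : μ = ν + u := (Multiset.filter_add_not _ μ).symm
  have hu1 : u = Multiset.replicate u.card 1 := by
    refine Multiset.eq_replicate_card.2 fun b hb => ?_
    rw [hu, Multiset.mem_filter] at hb
    have := hpos b hb.1
    omega
  have husum : u.sum = u.card := by
    conv_lhs => rw [hu1]
    simp
  have hνsum : ν.sum + u.card = n := by rw [← husum, ← Multiset.sum_add, ← hμ, hsum]
  have hνle : ∀ k ∈ ν, k ≤ n := fun k hk =>
    le_trans (Multiset.le_sum_of_mem hk) (by omega)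
  -- the padded list of non-unit parts and the grid point `κ`
  set L : List ℕ := ν.toList ++ List.replicate (w - ν.card) 0 with hL
  have hLlen : L.length = w := by
    rw [hL, List.length_append, Multiset.length_toList, List.length_replicate]; omega
  have hLle : ∀ x ∈ L, x ≤ n := by
    intro x hx
    rw [hL, List.mem_append, Multiset.mem_toList, List.mem_replicate] at hx
    rcases hx with hx | ⟨_, rfl⟩
    · exact hνle x hx
    · omega
  have hgetD : ∀ i : ℕ, L.getD i 0 ≤ n := by
    intro i
    rcases getD_mem_or_eq L 0 i with h | h
    · exact hLle _ h
    · omega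
  set κ : Fin w → Fin (n + 1) := fun i => ⟨L.getD i 0, Nat.lt_succ_of_le (hgetD i)⟩ with hκ
  -- products and sums along `κ`
  have hLprod : (L.map (psum (Fin n) ℂ)).prod = (ν.map (psum (Fin n) ℂ)).prod * (n : MvPolynomial (Fin n) ℂ) ^ (w - ν.card) := by
    rw [hL, List.map_append, List.prod_append, Multiset.prod_map_toList, List.map_replicate, List.prod_replicate,
      psum_zero, Fintype.card_fin]
  have hLsum : L.sum = ν.sum := by
    rw [hL, List.sum_append, Multiset.sum_toList, List.sum_replicate, smul_zero, add_zero]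
  have hκprod : ∏ i : Fin w, psum (Fin n) ℂ (κ i) = (L.map (psum (Fin n) ℂ)).prod := by
    rw [← prod_range_getD, hLlen, ← Fin.prod_univ_eq_prod_range (fun i => psum (Fin n) ℂ (L.getD i 0)) w]
  have hκsum : ∑ i : Fin w, (κ i : ℕ) = ν.sum := by
    rw [← hLsum, ← sum_range_getD, hLlen, ← Fin.sum_univ_eq_sum_range (fun i => L.getD i 0) w]
  have hκle : ∑ i : Fin w, (κ i : ℕ) ≤ n := by rw [hκsum]; omega
  have hmem := psumProd_mem_span_Q n w κ hκle
  rw [hκsum, hκprod, hLprod, show n - ν.sum = u.card by omega] at hmem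
  -- `p_1^{|u|} · (Π_ν p) · n^{w-|ν|}` versus `Π_μ p = (Π_ν p) · p_1^{|u|}`
  have hμprod : (μ.map (psum (Fin n) ℂ)).prod = (ν.map (psum (Fin n) ℂ)).prod * psum (Fin n) ℂ 1 ^ u.card := by
    conv_lhs => rw [hμ, Multiset.map_add, Multiset.prod_add, hu1]
    rw [Multiset.map_replicate, Multiset.prod_replicate]
  have hnpow : ((n : ℂ) ^ (w - ν.card)) ≠ 0 := pow_ne_zero _ (by exact_mod_cast (by omega : n ≠ 0))
  have h2 := Submodule.smul_mem _ (((n : ℂ) ^ (w - ν.card))⁻¹) hmem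
  rw [show psum (Fin n) ℂ 1 ^ u.card * ((ν.map (psum (Fin n) ℂ)).prod * (n : MvPolynomial (Fin n) ℂ) ^ (w - ν.card)) =
      ((n : ℂ) ^ (w - ν.card)) • ((ν.map (psum (Fin n) ℂ)).prod * psum (Fin n) ℂ 1 ^ u.card) by
    rw [smul_eq_C_mul, map_pow, map_natCast]; ring, smul_smul, inv_mul_cancel₀ hnpow, one_smul] at h2
  rw [hμprod]
  exact h2

/-! ### The equivariant normal form -/

/-- **Equivariant normal form.**  A row- and column-symmetric column-sml expression with `s < C(n-(w+1), w+1)` product gates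
(`2(w+1) ≤ n`) equals `Σ_τ Σ_g C (d τ) · Π_b Λ τ g b` for some grid coefficients `d`. [folklore] -/
theorem exists_equivariant_form {n s w : ℕ} (h2w : 2 * (w + 1) ≤ n) (α : Fin s → Fin n → Fin n → ℂ)
    (hrow : ∀ σ : Equiv.Perm (Fin n), rename (fun v : Fin n × Fin n => (σ v.1, v.2))
      (∑ t : Fin s, ∏ b : Fin n, ∑ a : Fin n, C (α t b a) * X (a, b) : MvPolynomial (Fin n × Fin n) ℂ) =
      ∑ t : Fin s, ∏ b : Fin n, ∑ a : Fin n, C (α t b a) * X (a, b))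
    (hcol : ∀ τ : Equiv.Perm (Fin n), rename (fun v : Fin n × Fin n => (v.1, τ v.2))
      (∑ t : Fin s, ∏ b : Fin n, ∑ a : Fin n, C (α t b a) * X (a, b) : MvPolynomial (Fin n × Fin n) ℂ) =
      ∑ t : Fin s, ∏ b : Fin n, ∑ a : Fin n, C (α t b a) * X (a, b))
    (hs : s < Nat.choose (n - (w + 1)) (w + 1)) :
    ∃ d : (Fin w → Fin (n + 1)) → ℂ,
      (∑ t : Fin s, ∏ b : Fin n, ∑ a : Fin n, C (α t b a) * X (a, b) : MvPolynomial (Fin n × Fin n) ℂ) =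
        ∑ τg : (Fin w → Fin (n + 1)) × (Fin w → Fin n), C (d τg.1) *
          ∏ b : Fin n, ∑ a : Fin n, C (1 + ∑ i : Fin w, if τg.2 i = a then ((τg.1 i : ℕ) : ℂ) else 0) * X (a, b) := by
  classical
  have hn : 1 ≤ n := by omega
  obtain ⟨b₀⟩ : Nonempty (Fin n) := ⟨⟨0, by omega⟩⟩
  -- Step 1: `p` is narrow, hence in the span of the `Q τ`
  obtain ⟨S, c, hS, hp⟩ := narrow_of_colSml_lt_choose h2w α hrow hcol hs
  have hpspan : rename (Prod.fst : Fin n × Fin n → Fin n)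
      (∑ t : Fin s, ∏ b : Fin n, ∑ a : Fin n, C (α t b a) * X (a, b)) ∈
      Submodule.span ℂ (Set.range fun τ : Fin w → Fin (n + 1) =>
        ∑ g : Fin w → Fin n, (psum (Fin n) ℂ 1 + ∑ i : Fin w, C (((τ i : ℕ) : ℂ)) * X (g i)) ^ n) := by
    rw [hp]
    refine Submodule.sum_mem _ fun μ hμ => Submodule.smul_mem _ _ ?_
    obtain ⟨hpos, hsum, hcard⟩ := hS μ hμ
    exact psumProd_multiset_mem_span_Q hn μ hpos hsum (by omega)
  obtain ⟨d, hd⟩ := (Submodule.mem_span_range_iff_exists_fun ℂ).1 hpspan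
  refine ⟨d, ?_⟩
  -- Step 2: the candidate as a pure column-sml expression (fold `d τ` into column `b₀`) and its properties
  set β : (Fin w → Fin (n + 1)) × (Fin w → Fin n) → Fin n → Fin n → ℂ := fun τg b a =>
    (if b = b₀ then d τg.1 else 1) * (1 + ∑ i : Fin w, if τg.2 i = a then ((τg.1 i : ℕ) : ℂ) else 0) with hβ
  have hfold : ∀ τg : (Fin w → Fin (n + 1)) × (Fin w → Fin n),
      (∏ b : Fin n, ∑ a : Fin n, C (β τg b a) * X (a, b) : MvPolynomial (Fin n × Fin n) ℂ) =
        C (d τg.1) * ∏ b : Fin n, ∑ a : Fin n,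
          C (1 + ∑ i : Fin w, if τg.2 i = a then ((τg.1 i : ℕ) : ℂ) else 0) * X (a, b) := by
    intro τg
    have hfac : ∀ b : Fin n, (∑ a : Fin n, C (β τg b a) * X (a, b) : MvPolynomial (Fin n × Fin n) ℂ) =
        C (if b = b₀ then d τg.1 else 1) *
          ∑ a : Fin n, C (1 + ∑ i : Fin w, if τg.2 i = a then ((τg.1 i : ℕ) : ℂ) else 0) * X (a, b) := by
      intro b
      simp only [hβ, map_mul, Finset.mul_sum, mul_assoc]
    simp_rw [hfac]
    rw [Finset.prod_mul_distrib, ← map_prod, Finset.prod_ite_eq']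
    simp
  have hcolβ : ∀ τ' : Equiv.Perm (Fin n), rename (fun v : Fin n × Fin n => (v.1, τ' v.2))
      (∑ t : (Fin w → Fin (n + 1)) × (Fin w → Fin n), ∏ b : Fin n, ∑ a : Fin n, C (β t b a) * X (a, b) :
        MvPolynomial (Fin n × Fin n) ℂ) =
      ∑ t : (Fin w → Fin (n + 1)) × (Fin w → Fin n), ∏ b : Fin n, ∑ a : Fin n, C (β t b a) * X (a, b) := by
    intro τ'
    simp_rw [hfold]
    rw [map_sum]
    refine Finset.sum_congr rfl fun τg _ => ?_
    rw [map_mul, rename_C]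
    congr 1
    simp only [map_prod, map_sum, map_mul, rename_C, rename_X]
    exact Fintype.prod_equiv τ' _ _ fun b => rfl
  have hrenβ : rename (Prod.fst : Fin n × Fin n → Fin n)
      (∑ t : (Fin w → Fin (n + 1)) × (Fin w → Fin n), ∏ b : Fin n, ∑ a : Fin n, C (β t b a) * X (a, b)) =
      rename (Prod.fst : Fin n × Fin n → Fin n)
        (∑ t : Fin s, ∏ b : Fin n, ∑ a : Fin n, C (α t b a) * X (a, b)) := by
    rw [← hd]
    simp_rw [hfold]
    rw [map_sum, Fintype.sum_prod_type]
    refine Finset.sum_congr rfl fun τ _ => ?_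
    rw [Finset.smul_sum]
    refine Finset.sum_congr rfl fun g _ => ?_
    rw [map_mul, rename_C, rename_fst_prod_genFactor, smul_eq_C_mul]
  -- Step 3: uniqueness
  have huniq := colSml_eq_of_rename_fst_eq α β hcol hcolβ hrenβ.symm
  rw [huniq]
  exact Finset.sum_congr rfl fun τg _ => hfold τg

end Summit.ValiantsHypothesis.ValiantsHypothesis.Theorems.SmlEquivariantForm
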